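import Summits.QuantumFields.BalabanUV.T4Continuum.Support.NE7WhitneyLiftDefect
import Summits.QuantumFields.BalabanUV.T4Continuum.Support.NE7StencilInverse
import Summits.QuantumFields.BalabanUV.T4Continuum.Support.NE3SmoothRightInverseCurl
import HarnessLib

/-!
# NE7WhitneyExactLiftFlat — THE EXACT ONE-STEP LIFT OF RECORD AT THE FLAT BACKGROUND, EXPLICITLY: `r w := W(B_c⁻¹w − gaugeDir_1(Θ B_c⁻¹w))`,
# **`cpush M 1 (r w) = w`** for every `N`-periodic coarse datum, and the EXACT de Rham commutation **`curl_1 (r w) = M⁻²•interp(B_c⁻¹(curl_1 w))`** — curl by curl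
# (lineage `b2b-balaban-t4-ne7b-p1`, gen 162; route (H′), memo `t4/b2b-balaban-t4-ne7b-p1/g162/records/SCOPING-LEVELMASSES.md` §8–§9, file (R1b))

Cell `pub-balaban`, rung (B)+1 sub-cell t4, lineage `b2b-balaban-t4-ne7b-p1` (row NE7b OWNER + CRUX PROVER; junction service for row NE7 on ROAD-G116 §6 (G3)), generation 162.
WHY.  Route (H′) (budget ✓ `NE7LevelMassBudget`, one-level step ✓ `NE7OneLevelSliceStep`) needs at every level an EXACT right inverse `r` of the one-step linearised average whose curl is
controlled by the COARSE curl ((L2): otherwise row NE3's slice constant enters the compounding) and whose composites are bounded ((C), memo §9 numerics: `C_ℓ = 46, 125, 202, …` convergent at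
`d = 4`, `L = 2`).  By ✓ W1b (`cpush_1(Wφ) = gaugeDir_1(Θφ) + B_cφ`, gauge directions reproduced EXACTLY) and ✓ `NE7StencilInverse` (`B_c⁻¹ = stencilInv` on periodic fields) the lift is explicit —
no abstract inverse, no Fourier analysis: `A := cpush_1∘W` fixes gauge directions, so `A⁻¹ = (1 − gaugeDir_1∘Θ)∘B_c⁻¹`.
WHAT ([folklore]; 0 def, 0 sorry; `d` arbitrary; the lift `W`, the stencil inverse `B_c⁻¹ w (y,κ) = stencilInv N c (w·κ) y` with `c = (M−1)∕(2M)`, the frame datum `Θφ(y) = F̂(Wφ)(M•y)` and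
`r w := W(B_c⁻¹w − gaugeDir flatCfg (Θ(B_c⁻¹w)))` are WRITTEN OUT):
§1 `whitney_c_nonneg`, `whitney_c_lt_half`; `cpush_flatCfg_sub` (the flat one-step average is subtractive); `whitneyLift_sub`;
§2 **`interpCore_stencilInv_datum`**: `interpCore univ (B_c⁻¹w · κ) y (const c) = w y κ` (`w` `N`-periodic) — ✓ `NE7StencilInverse.interpCore_stencilInv`;
§3 **`cpush_flatCfg_exactLift`** — THE EXACTNESS: for `M, N ≥ 1` and `w` `N`-periodic in every direction, `cpush M flatCfg (r w) = w`;
§4 `stencilInv_sub`, **`curlAt_flat_stencilInv`** (`B_c⁻¹` commutes with the flat curl), `curlAt_flat_gaugeDir_flatCfg` (`= 0`), and **`curlAt_flat_exactLift`** — THE DE RHAM LETTER, EXACT (`μ ≠ ν`):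
   `curlAt 1 (r w) z μ ν = (M²)⁻¹ • interp M ((univ∖{μ})∖{ν}) (stencilInv N c (curlAt 1 w · μ ν)) z`; corollary **`curlAt_flat_exactLift_of_curlFree`**: curl-free data lift curl-free.
WHAT IS NOT HERE: periodicity∕skewness bookkeeping and the `ℓ²` letters of `r` (mass `C_1`, curl `C_c` — file (R2)), the composite letter (C) (file (R3)), the curved transport (R4).
HONEST FRAMING (page 1): flat lattice kinematics of OUR lift; nothing of Bałaban's asserted ([Balaban1985Averaging] (42), (47)–(48), (110)–(125) context only); NOT (G3), NOT (G), NOT NE7∕NE3 as spine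
nodes; row NE7b NOT PRINTED ∕ NOT PROVED; spine 0∕9; finite T⁴ rung (B)+1 — NOT infinite volume, NOT mass gap, NOT BetaPertH, NOT Clay.
-/

set_option autoImplicit false

open scoped BigOperators Matrix Matrix.Norms.L2Operator
open Finset

namespace Summit.QuantumFields.BalabanUV.T4Continuum.NE7WhitneyExactLiftFlat

open Literature.MathematicalPhysics.QuantumFieldTheory.Balaban1983to89
open B7Prop1Explicit B7Prop2Explicit
open T4AveragingDeficitWall (curlAt)
open AveragingDeficitMultiLevelPrep (cpush)
open B7Prop3Flat (Fhat linQ)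
open BlockAveragePushDirGauge (gaugeDir)
open BlockAveragePushDirSplit (flat)
open MinimalActionWitness (flatCfg)
open SmoothRefineInterp (interp interpCore cfd interp_sub interp_smul interpCore_const)
open NE3TangentFlatStructure (linQ_sub)
open NE3TangentFlatPush (cpush_flatCfg gaugeDir_flatCfg flatCfg_eq_flat)
open NE3TangentNoGoWords (dPot)
open NE3SmoothLiftCurl (curlAt_flat_eq)
open NE3SmoothRightInverseCurl (curlAt_flat_dPot)
open NE7WhitneyLiftFlat (curlAt_flat_whitneyLift)
open NE7WhitneyLiftAverage (cpush_flatCfg_whitneyLift cpush_flatCfg_whitneyLift_gaugeDir)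
open NE7WhitneyLiftDefect (Fhat_sub')
open NE7StencilInverse (stencilInv interpCore_stencilInv stencilInv_shift stencilInv_add stencilInv_smul stencilInv_zero)

noncomputable section

variable {d : ℕ} {n : Type*} [Fintype n] [DecidableEq n]

/-! ## §1 Parameters and linearity bookkeeping -/

omit [Fintype n] [DecidableEq n] in
/-- `0 ≤ (M−1)∕(2M)` for `M ≥ 1`. [folklore] -/
theorem whitney_c_nonneg {M : ℕ} (hM : 1 ≤ M) : (0 : ℝ) ≤ ((M : ℝ) - 1) / (2 * M) := by
  have : (1 : ℝ) ≤ M := by exact_mod_cast hM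
  exact div_nonneg (by linarith) (by positivity)

omit [Fintype n] [DecidableEq n] in
/-- `(M−1)∕(2M) < 1∕2` for `M ≥ 1`. [folklore] -/
theorem whitney_c_lt_half {M : ℕ} (hM : 1 ≤ M) : ((M : ℝ) - 1) / (2 * M) < 1 / 2 := by
  have hM0 : (0 : ℝ) < M := by exact_mod_cast (show 0 < M by omega)
  rw [div_lt_div_iff₀ (by positivity) (by norm_num)]
  linarith

/-- The flat one-step linearised average is subtractive in the direction (`M ≥ 1`). [folklore] -/
theorem cpush_flatCfg_sub {M : ℕ} (hM : 1 ≤ M) (A B : Site d → Fin d → Matrix n n ℂ) :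
    cpush M (flatCfg (d := d) (n := n)) (fun z κ => A z κ - B z κ)
      = fun y κ => cpush M (flatCfg (d := d) (n := n)) A y κ - cpush M (flatCfg (d := d) (n := n)) B y κ := by
  funext y κ
  rw [cpush_flatCfg M hM, cpush_flatCfg M hM, cpush_flatCfg M hM, Fhat_sub', Fhat_sub', linQ_sub]
  abel

omit [Fintype n] [DecidableEq n] in
/-- The lift is subtractive in the datum. [folklore] -/
theorem whitneyLift_sub (M : ℕ) (φ ψ : Site d → Fin d → Matrix n n ℂ) :
    (fun z κ' => ((M : ℝ)⁻¹) • interp M (Finset.univ.erase κ') (fun w => φ w κ' - ψ w κ') z)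
      = fun z κ' => ((M : ℝ)⁻¹) • interp M (Finset.univ.erase κ') (fun w => φ w κ') z
          - ((M : ℝ)⁻¹) • interp M (Finset.univ.erase κ') (fun w => ψ w κ') z := by
  funext z κ'
  rw [interp_sub, smul_sub]

/-! ## §2 The stencil inverse undoes the straight average of the lift -/

omit [Fintype n] [DecidableEq n] in
/-- **`interpCore univ (B_c⁻¹w · κ) y (const c) = w y κ`** for `N`-periodic `w` (`M, N ≥ 1`, `c = (M−1)∕(2M)`). [folklore] -/
theorem interpCore_stencilInv_datum {M N : ℕ} (hM : 1 ≤ M) (hN : 1 ≤ N) {w : Site d → Fin d → Matrix n n ℂ}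
    (hw : ∀ (y : Site d) (j κ : Fin d), w (y + (N : ℤ) • e j) κ = w y κ) (y : Site d) (κ : Fin d) :
    interpCore Finset.univ (fun x => stencilInv N (((M : ℝ) - 1) / (2 * M)) (fun x' => w x' κ) x) y (fun _ => ((M : ℝ) - 1) / (2 * M)) = w y κ :=
  interpCore_stencilInv (whitney_c_nonneg hM) (whitney_c_lt_half hM) hN (fun j x => hw x j κ) y

/-! ## §3 THE EXACTNESS: `cpush_1 (r w) = w` -/

/-- **THE EXACT ONE-STEP LIFT OF RECORD (flat background)** (`M, N ≥ 1`; `w` `N`-periodic in every direction).  With `φ := B_c⁻¹ w` (componentwise `stencilInv N c`, `c = (M−1)∕(2M)`),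
`ν := Θφ = F̂(Wφ)(M•·)` and the corrected datum `ψ := φ − gaugeDir flatCfg ν`, the lift `r w := Wψ` is an EXACT right inverse of the flat one-step linearised average:
`cpush M flatCfg (r w) = w` — `cpush_1(Wφ) = gaugeDir_1 ν + B_c φ = gaugeDir_1 ν + w` (✓ W1b + §2) and `cpush_1(W(gaugeDir_1 ν)) = gaugeDir_1 ν` (✓ W1b). [folklore] -/
theorem cpush_flatCfg_exactLift {M N : ℕ} (hM : 1 ≤ M) (hN : 1 ≤ N) {w : Site d → Fin d → Matrix n n ℂ}
    (hw : ∀ (y : Site d) (j κ : Fin d), w (y + (N : ℤ) • e j) κ = w y κ) :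
    cpush M (flatCfg (d := d) (n := n))
      (fun z κ' => ((M : ℝ)⁻¹) • interp M (Finset.univ.erase κ')
        (fun x => stencilInv N (((M : ℝ) - 1) / (2 * M)) (fun x' => w x' κ') x
          - gaugeDir (flatCfg (d := d) (n := n))
              (fun y => Fhat M (fun z κ'' => ((M : ℝ)⁻¹) • interp M (Finset.univ.erase κ'')
                (fun x'' => stencilInv N (((M : ℝ) - 1) / (2 * M)) (fun x' => w x' κ'') x'') z) ((M : ℤ) • y)) x κ') z)
      = w := by
  set c : ℝ := ((M : ℝ) - 1) / (2 * M) with hc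
  set φ : Site d → Fin d → Matrix n n ℂ := fun x κ => stencilInv N c (fun x' => w x' κ) x with hφ
  set ν : Site d → Matrix n n ℂ := fun y => Fhat M (fun z κ'' => ((M : ℝ)⁻¹) • interp M (Finset.univ.erase κ'') (fun x'' => φ x'' κ'') z) ((M : ℤ) • y) with hν
  show cpush M flatCfg (fun z κ' => ((M : ℝ)⁻¹) • interp M (Finset.univ.erase κ') (fun x => φ x κ' - gaugeDir flatCfg ν x κ') z) = w
  rw [whitneyLift_sub, cpush_flatCfg_sub hM, cpush_flatCfg_whitneyLift_gaugeDir hM ν]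
  funext y κ
  rw [cpush_flatCfg_whitneyLift hM φ y κ, gaugeDir_flatCfg]
  have hst : interpCore Finset.univ (fun x => φ x κ) y (fun _ => ((M : ℝ) - 1) / (2 * M)) = w y κ := by
    simp only [hφ, hc]
    exact interpCore_stencilInv_datum hM hN hw y κ
  rw [hst]
  simp only [hν, smul_add]
  abel

/-! ## §4 THE DE RHAM LETTER: the curl of the lift is the interpolated stencil inverse of the coarse curl -/

section StencilCurl

variable {X : Type*} [AddCommGroup X] [Module ℝ X]

omit [Fintype n] [DecidableEq n] in
/-- `stencilInv` is subtractive. [folklore] -/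
theorem stencilInv_sub (N : ℕ) (c : ℝ) (G H : Site d → X) (y : Site d) :
    stencilInv N c (fun x => G x - H x) y = stencilInv N c G y - stencilInv N c H y := by
  have h := stencilInv_add N c G (fun x => (-1 : ℝ) • H x) y
  rw [stencilInv_smul] at h
  simp only [neg_one_smul, ← sub_eq_add_neg] at h
  exact h

end StencilCurl

/-- **`B_c⁻¹` COMMUTES WITH THE FLAT CURL**: `curlAt 1 (B_c⁻¹ w) z μ ν = stencilInv N c (curlAt 1 w · μ ν) z` (a fixed combination of translates; ✓ `stencilInv_shift`). [folklore] -/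
theorem curlAt_flat_stencilInv (N : ℕ) (c : ℝ) (w : Site d → Fin d → Matrix n n ℂ) (z : Site d) (μ ν : Fin d) :
    curlAt (flat (d := d) (n := n)) (fun x κ => stencilInv N c (fun x' => w x' κ) x) z μ ν
      = stencilInv N c (fun x => curlAt (flat (d := d) (n := n)) w x μ ν) z := by
  rw [curlAt_flat_eq]
  have h : (fun x => curlAt (flat (d := d) (n := n)) w x μ ν) = fun x => (w (x + e μ) ν - w x ν) - (w (x + e ν) μ - w x μ) := by
    funext x; rw [curlAt_flat_eq]
  have e1 : stencilInv N c (fun x => w (x + e μ) ν) z = stencilInv N c (fun x' => w x' ν) (z + e μ) := stencilInv_shift N c (fun x' => w x' ν) (e μ) z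
  have e2 : stencilInv N c (fun x => w (x + e ν) μ) z = stencilInv N c (fun x' => w x' μ) (z + e ν) := stencilInv_shift N c (fun x' => w x' μ) (e ν) z
  rw [h, stencilInv_sub, stencilInv_sub, stencilInv_sub, e1, e2]

/-- The flat curl of a flat gauge direction vanishes. [folklore] -/
theorem curlAt_flat_gaugeDir_flatCfg (ν' : Site d → Matrix n n ℂ) (z : Site d) (μ ν : Fin d) :
    curlAt (flat (d := d) (n := n)) (gaugeDir (flatCfg (d := d) (n := n)) ν') z μ ν = 0 := by
  have h : gaugeDir (flatCfg (d := d) (n := n)) ν' = fun x κ => (fun _ _ => (0 : Matrix n n ℂ)) x κ - dPot ν' x κ := by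
    funext x κ; rw [gaugeDir_flatCfg]; simp [dPot]
  rw [h, NE3CurlOfGaugeDir.curlAt_sub, curlAt_flat_dPot, sub_zero, curlAt_flat_eq]
  simp

/-- **THE DE RHAM LETTER OF THE EXACT LIFT, EXACT** (`M ≥ 1`, `μ ≠ ν`): with `φ = B_c⁻¹w`, `ν' = Θφ`, `r w = W(φ − gaugeDir_1 ν')`,
`curlAt 1 (r w) z μ ν = (M²)⁻¹ • interp M ((univ∖{μ})∖{ν}) (stencilInv N c (curlAt 1 w · μ ν)) z` — the curl of the lift is the transverse interpolant of the stencil inverse of the COARSE curl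
(✓ `curlAt_flat_whitneyLift` + the flat curl kills gauge directions + `B_c⁻¹` commutes with the curl).  Stated for an arbitrary gauge generator `ν'` (the exactness correction is one). [folklore] -/
theorem curlAt_flat_exactLift {M : ℕ} (hM : 1 ≤ M) (N : ℕ) (w : Site d → Fin d → Matrix n n ℂ) (ν' : Site d → Matrix n n ℂ)
    (z : Site d) {μ ν : Fin d} (hμν : μ ≠ ν) :
    curlAt (flat (d := d) (n := n))
      (fun x κ' => ((M : ℝ)⁻¹) • interp M (Finset.univ.erase κ')
        (fun x' => stencilInv N (((M : ℝ) - 1) / (2 * M)) (fun x'' => w x'' κ') x' - gaugeDir (flatCfg (d := d) (n := n)) ν' x' κ') x) z μ ν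
      = (((M : ℝ) ^ 2)⁻¹) • interp M ((Finset.univ.erase μ).erase ν)
          (fun y => stencilInv N (((M : ℝ) - 1) / (2 * M)) (fun x => curlAt (flat (d := d) (n := n)) w x μ ν) y) z := by
  set c : ℝ := ((M : ℝ) - 1) / (2 * M) with hc
  set ψ : Site d → Fin d → Matrix n n ℂ := fun x' κ' => stencilInv N c (fun x'' => w x'' κ') x' - gaugeDir (flatCfg (d := d) (n := n)) ν' x' κ' with hψ
  have h1 := curlAt_flat_whitneyLift (n := n) hM ψ z hμν
  have h2 : (fun y => curlAt (flat (d := d) (n := n)) ψ y μ ν) = fun y => stencilInv N c (fun x => curlAt (flat (d := d) (n := n)) w x μ ν) y := by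
    funext y
    rw [hψ, NE3CurlOfGaugeDir.curlAt_sub, curlAt_flat_gaugeDir_flatCfg, sub_zero, curlAt_flat_stencilInv]
  rw [h2] at h1
  exact h1

/-- **CURL-FREE DATA LIFT CURL-FREE** (`M ≥ 1`, `μ ≠ ν`): if `curlAt 1 w y μ ν = 0` for all `y`, then `curlAt 1 (r w) z μ ν = 0` (for any gauge generator `ν'` in the correction). [folklore] -/
theorem curlAt_flat_exactLift_of_curlFree {M : ℕ} (hM : 1 ≤ M) (N : ℕ) {w : Site d → Fin d → Matrix n n ℂ} (ν' : Site d → Matrix n n ℂ)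
    (z : Site d) {μ ν : Fin d} (hμν : μ ≠ ν) (hw : ∀ y : Site d, curlAt (flat (d := d) (n := n)) w y μ ν = 0) :
    curlAt (flat (d := d) (n := n))
      (fun x κ' => ((M : ℝ)⁻¹) • interp M (Finset.univ.erase κ')
        (fun x' => stencilInv N (((M : ℝ) - 1) / (2 * M)) (fun x'' => w x'' κ') x' - gaugeDir (flatCfg (d := d) (n := n)) ν' x' κ') x) z μ ν = 0 := by
  rw [curlAt_flat_exactLift hM N w ν' z hμν]
  have h0 : (fun x => curlAt (flat (d := d) (n := n)) w x μ ν) = fun _ => (0 : Matrix n n ℂ) := by funext x; exact hw x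
  rw [h0]
  have h1 : (fun y => stencilInv N (((M : ℝ) - 1) / (2 * M)) (fun _ : Site d => (0 : Matrix n n ℂ)) y) = fun _ => (0 : Matrix n n ℂ) := by
    funext y; exact stencilInv_zero N _ y
  rw [h1]
  unfold interp
  rw [interpCore_const, smul_zero]

end

end Summit.QuantumFields.BalabanUV.T4Continuum.NE7WhitneyExactLiftFlat
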